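import Summits.AtomisticToContinuum.HydrodynamicLimit.Theses.OneFlightGossipEngine
import Summits.AtomisticToContinuum.HydrodynamicLimit.Theorems.OneFlightGossipEngineClampedCurrentsDockPathwise
import Summits.AtomisticToContinuum.HydrodynamicLimit.Theorems.OneFlightGossipEngineClampedCurrentsDockCollisionalIdPrelim
import Summits.AtomisticToContinuum.HydrodynamicLimit.Theorems.OneFlightGossipEngineClampedCurrentsDockEntropyStep
import Literature.Analysis.FluidPDE.HardSphereCollisionRecord
import Literature.Analysis.FluidPDE.HardSphereFlowJointMeasurable
import Literature.MathematicalPhysics.KineticTheory.HardSphereEulerProofs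
import Literature.MathematicalPhysics.KineticTheory.HardSphereTwoTimePressure
import HarnessLib

/-!
# Tools for the heart of Yau's entropy ledger (crux `ClampedCurrentsDock`, stmt-14680, line `IdeatorTwoSketch`)

Helper file (`--supports stmt-AtomisticToContinuum-14680`) for the registered stub `stub_oneWindowLedger` (the heart): the
contact-scale bound of a pair kernel with general Lipschitz test functions (used for the time-freezing of the collision kernel),
real-integral bounds from `lintegral` bounds, interval-integrability of one-body functionals and of the streaming rate along a good
orbit, measurable versions of window functionals carried by the good set, and the window-size arithmetic
`τ (N+1)^{-1/3} ≤ δ` for `N` large. prover-line-stmt-AtomisticToContinuum-14680-c2-0 (lead c2).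
-/

noncomputable section

namespace Summit.AtomisticToContinuum.HydrodynamicLimit.Theorems.ClampedCurrentsDockHeart

open scoped BigOperators ENNReal Classical Interval
open MeasureTheory Filter Set Topology InformationTheory
open Literature.MathematicalPhysics.KineticTheory Literature.Analysis.FluidPDE Literature.Analysis.FunctionSpaces
open Summit.AtomisticToContinuum.HydrodynamicLimit.Theorems
open Summit.AtomisticToContinuum.HydrodynamicLimit.Theorems.ClampedCurrentsDockPathwise
open Summit.AtomisticToContinuum.HydrodynamicLimit.Theorems.ClampedCurrentsDockCollisionalIdPrelim
open Summit.AtomisticToContinuum.HydrodynamicLimit.Theorems.ClampedCurrentsDockEntropyStep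
open Summit.AtomisticToContinuum.HydrodynamicLimit.Theorems.HemisphereAffineSlaving.BalanceIdentity

/-! ## §1 The pair kernel with general Lipschitz test functions -/

/-- **Contact-scale bound of a pair kernel with general test functions**: if the three momentum-row test functions `f k`
and the energy-row test function `g` are `L`-Lipschitz for the minimal-image distance and the two partners of the record are
at distance `≤ ε`, then `|(Σ_k (f_k(x₁) − f_k(x₂))Δv_k − (g(x₁) − g(x₂))Δe)/2| ≤ L ε (‖Δv‖ + |Δ‖v‖²|/2)`. [folklore] -/
theorem abs_pairKernelGen_le {M : ℕ} {f : Fin 3 → T3 → ℝ} {g : T3 → ℝ} {L ε : ℝ} (hL : 0 ≤ L) (hε : 0 ≤ ε)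
    (hLm : ∀ (k : Fin 3) (x y : T3), |f k x - f k y| ≤ L * Torus.euclidDist x y)
    (hLe : ∀ x y : T3, |g x - g y| ≤ L * Torus.euclidDist x y)
    (c : HardSphereCollisionRecord (Fin 3) T3 M) (hc : Torus.euclidDist c.fstPos c.sndPos ≤ ε) :
    |((∑ k : Fin 3, (f k c.fstPos - f k c.sndPos) * (c.postVel.1 k - c.preVel.1 k)) -
        (g c.fstPos - g c.sndPos) * ((‖c.postVel.1‖ ^ 2 - ‖c.preVel.1‖ ^ 2) / 2)) / 2| ≤
      L * ε * (‖c.postVel.1 - c.preVel.1‖ + |‖c.postVel.1‖ ^ 2 - ‖c.preVel.1‖ ^ 2| / 2) := by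
  -- adapted from `ClampedCurrentsDockCollisionalIdPrelim.abs_pairKernel_le`
  have hLε : 0 ≤ L * ε := mul_nonneg hL hε
  have h1 : ∀ k, |(f k c.fstPos - f k c.sndPos) * (c.postVel.1 k - c.preVel.1 k)| ≤
      L * ε * |(c.postVel.1 - c.preVel.1) k| := fun k => by
    rw [abs_mul, PiLp.sub_apply]
    exact mul_le_mul_of_nonneg_right ((hLm k _ _).trans (by gcongr)) (abs_nonneg _)
  have h2 : |(g c.fstPos - g c.sndPos) * ((‖c.postVel.1‖ ^ 2 - ‖c.preVel.1‖ ^ 2) / 2)| ≤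
      L * ε * (|‖c.postVel.1‖ ^ 2 - ‖c.preVel.1‖ ^ 2| / 2) := by
    rw [abs_mul, abs_div, abs_two]
    refine mul_le_mul_of_nonneg_right ?_ (by positivity)
    exact (hLe c.fstPos c.sndPos).trans (by gcongr)
  have h3 := sum_abs_apply_le_two_mul_norm (c.postVel.1 - c.preVel.1)
  have h4 : |∑ k : Fin 3, (f k c.fstPos - f k c.sndPos) * (c.postVel.1 k - c.preVel.1 k)| ≤
      L * ε * (2 * ‖c.postVel.1 - c.preVel.1‖) := by
    refine (Finset.abs_sum_le_sum_abs _ _).trans ((Finset.sum_le_sum fun k _ => h1 k).trans ?_)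
    rw [← Finset.mul_sum]
    exact mul_le_mul_of_nonneg_left h3 hLε
  have h5 := abs_sub (∑ k : Fin 3, (f k c.fstPos - f k c.sndPos) * (c.postVel.1 k - c.preVel.1 k))
    ((g c.fstPos - g c.sndPos) * ((‖c.postVel.1‖ ^ 2 - ‖c.preVel.1‖ ^ 2) / 2))
  have h6 : 0 ≤ L * ε * |‖c.postVel.1‖ ^ 2 - ‖c.preVel.1‖ ^ 2| := mul_nonneg hLε (abs_nonneg _)
  rw [abs_div, abs_two]
  nlinarith [h2, h4, h5, h6, norm_nonneg (c.postVel.1 - c.preVel.1)]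

/-! ## §2 Real integrals from `lintegral` bounds -/

/-- A nonnegative a.e.-strongly measurable function whose `lintegral` is at most `ofReal c` (`c ≥ 0`) is integrable with
integral at most `c`. [folklore] -/
theorem integrable_and_integral_le_of_lintegral_le {α : Type*} [MeasurableSpace α] {μ : Measure α} {f : α → ℝ} {c : ℝ}
    (hf : AEStronglyMeasurable f μ) (h0 : 0 ≤ᵐ[μ] f) (hc : 0 ≤ c)
    (h : ∫⁻ x, ENNReal.ofReal (f x) ∂μ ≤ ENNReal.ofReal c) : Integrable f μ ∧ ∫ x, f x ∂μ ≤ c := by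
  have hfin : HasFiniteIntegral f μ := by
    refine (hasFiniteIntegral_iff_ofReal h0).2 ?_
    exact h.trans_lt ENNReal.ofReal_lt_top
  have hint : Integrable f μ := ⟨hf, hfin⟩
  refine ⟨hint, ?_⟩
  rw [← ENNReal.ofReal_le_ofReal_iff hc, ofReal_integral_eq_lintegral_ofReal hint h0]
  exact h

/-- For `0 ≤ V`: `A ≤ V + 1{V < A} A`. [folklore] -/
theorem le_add_indicator_of_nonneg {A V : ℝ} (hV : 0 ≤ V) :
    A ≤ V + Set.indicator {y : ℝ | V < y} (fun y => y) A := by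
  by_cases h : V < A
  · rw [Set.indicator_of_mem (show A ∈ {y : ℝ | V < y} from h)]
    linarith
  · rw [Set.indicator_of_notMem (show A ∉ {y : ℝ | V < y} from h)]
    linarith [not_lt.1 h]

/-- The tail functional `1{V < A} A` is nonnegative for `0 ≤ V`. [folklore] -/
theorem indicator_tail_nonneg {A V : ℝ} (hV : 0 ≤ V) : 0 ≤ Set.indicator {y : ℝ | V < y} (fun y => y) A := by
  by_cases h : V < A
  · rw [Set.indicator_of_mem (show A ∈ {y : ℝ | V < y} from h)]; exact hV.trans h.le
  · rw [Set.indicator_of_notMem (show A ∉ {y : ℝ | V < y} from h)]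

/-! ## §3 Along a good orbit -/

section Orbit

variable {ε : ℝ} {M : ℕ}

/-- A continuous one-body functional of ONE particle is interval integrable along a good orbit. [folklore] -/
theorem intervalIntegrable_orbit_apply (Φ : HardSphereFlow (Torus.geometry (Fin 3)) ε M)
    {z : Config M (Fin 3) T3} (hz : z ∈ Φ.good) {F : T3 × V3 → ℝ} (hF : Continuous F) (i : Fin M) (a b : ℝ) :
    IntervalIntegrable (fun r => F (Φ.flow r z i)) volume a b := by
  obtain ⟨C, hC⟩ := (isCompact_univ.prod (isCompact_closedBall (0 : V3) (1 + 2 * configEnergy z)))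
    |>.exists_bound_of_continuousOn hF.continuousOn
  have hmeas : Measurable fun r => F (Φ.flow r z i) :=
    hF.measurable.comp ((measurable_pi_apply i).comp (measurable_orbit Φ hz))
  have hbd : ∀ r, ‖F (Φ.flow r z i)‖ ≤ C := fun r =>
    hC _ (Set.mem_prod.2 ⟨mem_univ _, mem_closedBall_zero_iff.2 (norm_vel_flow_le Φ hz r i)⟩)
  exact (IntegrableOn.of_bound isCompact_uIcc.measure_lt_top hmeas.aestronglyMeasurable _
    (ae_of_all _ hbd)).intervalIntegrable

/-- Sum and integral commute for continuous one-body functionals along a good orbit. [folklore] -/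
theorem integral_sum_orbit (Φ : HardSphereFlow (Torus.geometry (Fin 3)) ε M)
    {z : Config M (Fin 3) T3} (hz : z ∈ Φ.good) {F : T3 × V3 → ℝ} (hF : Continuous F) (a b : ℝ) :
    ∫ r in a..b, ∑ i, F (Φ.flow r z i) = ∑ i, ∫ r in a..b, F (Φ.flow r z i) :=
  intervalIntegral.integral_finsetSum fun i _ => intervalIntegrable_orbit_apply Φ hz hF i a b

/-- **The streaming rate of the local-Gibbs exponent is interval integrable along a good orbit** (the analytic inputs of
the localized balance law, as in `ClampedCurrentsDockPathwise.gSum_sub_eq`). [folklore] -/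
theorem intervalIntegrable_DgSum {σ T : ℝ} {N : ℕ} (Φ : HardSphereFlow (Torus.geometry (Fin 3)) (hsDiameter σ N) (N + 1))
    {a θ : ℝ → T3 → ℝ} {u : ℝ → T3 → V3}
    (ha : Torus.IsSmoothSpaceTimeOn (Ico 0 T) a) (hθ : Torus.IsSmoothSpaceTimeOn (Ico 0 T) θ)
    (hu : Torus.IsSmoothSpaceTimeOn (Ico 0 T) u) (ha0 : ∀ t ∈ Ico 0 T, ∀ x, 0 < a t x)
    (hθ0 : ∀ t ∈ Ico 0 T, ∀ x, 0 < θ t x) {z : Config (N + 1) (Fin 3) T3} (hz : z ∈ Φ.good) {s h : ℝ}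
    (hs : 0 ≤ s) (hh : 0 ≤ h) (hshT : s + h < T) :
    IntervalIntegrable (fun r => DgSum T a θ u r (Φ.flow r z)) volume s (s + h) := by
  -- adapted from `ClampedCurrentsDockPathwise.gSum_sub_eq` (first component of the localized balance law)
  have htraj := Φ.isTrajectory z hz
  have hU : UniqueDiffOn ℝ (Ico 0 T) := uniqueDiffOn_Ico 0 T
  have hIcc : Icc s (s + h) ⊆ Ico 0 T := fun r hr => ⟨hs.trans hr.1, hr.2.trans_lt hshT⟩
  have hg := fun v : V3 => isSmoothSpaceTimeOn_gExp ha hθ hu ha0 hθ0 v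
  have hF : ∀ (w : Config (N + 1) (Fin 3) T3) (t₀ : ℝ), ∀ r ∈ Ioo s (s + h),
      HasDerivAt (fun r => gSum a θ u r (freeFlight (Torus.geometry (Fin 3)) (r - t₀) w))
        (DgSum T a θ u r (freeFlight (Torus.geometry (Fin 3)) (r - t₀) w)) r := by
    intro w t₀ r hr
    have hrS : Ico 0 T ∈ 𝓝 r :=
      mem_of_superset (Ioo_mem_nhds (hs.trans_lt hr.1) (hr.2.trans hshT)) Ioo_subset_Ico_self
    simp only [gSum, DgSum, DgExp, freeFlight_apply, Torus.geometry_translate]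
    exact HasDerivAt.fun_sum fun i _ => hasDerivAt_slice_freeFlight (hg (w i).2) hU hrS (w i).1 (w i).2 t₀
  have hFc : ∀ (w : Config (N + 1) (Fin 3) T3) (t₀ : ℝ),
      ContinuousOn (fun r => gSum a θ u r (freeFlight (Torus.geometry (Fin 3)) (r - t₀) w)) (Icc s (s + h)) := by
    intro w t₀
    simp only [gSum, freeFlight_apply, Torus.geometry_translate]
    exact continuousOn_finsetSum _ fun i _ =>
      (continuousOn_slice_freeFlight (hg (w i).2).continuousOn_stLift (w i).1 (w i).2 t₀).mono hIcc
  have hF'c : ∀ (w : Config (N + 1) (Fin 3) T3) (t₀ : ℝ),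
      ContinuousOn (fun r => DgSum T a θ u r (freeFlight (Torus.geometry (Fin 3)) (r - t₀) w)) (Icc s (s + h)) := by
    intro w t₀
    simp only [DgSum, DgExp, freeFlight_apply, Torus.geometry_translate]
    refine continuousOn_finsetSum _ fun i _ => ContinuousOn.mono ?_ hIcc
    refine (continuousOn_slice_freeFlight ((hg (w i).2).timeDerivWithin hU).continuousOn_stLift
      (w i).1 (w i).2 t₀).add (continuousOn_finsetSum _ fun k _ => continuousOn_const.mul ?_)
    exact continuousOn_slice_freeFlight ((hg (w i).2).partialDeriv hU k).continuousOn_stLift (w i).1 (w i).2 t₀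
  exact (sub_eq_integral_add_finsum_collisionJump_loc htraj torus_continuous_translate hF hFc
    (fun w t₀ => (hF'c w t₀).intervalIntegrable_of_Icc (le_add_of_nonneg_right hh)) le_rfl
    (le_add_of_nonneg_right hh) le_rfl).1

/-- **Measurable version of a window functional carried by the good set**: a real function on phase space whose restriction
to `Φ.good` is measurable agrees on `Φ.good` with a measurable function. [folklore] -/
theorem exists_measurable_eqOn_good (Φ : HardSphereFlow (Torus.geometry (Fin 3)) ε M)
    {f : Config M (Fin 3) T3 → ℝ} (hf : Measurable fun z : Φ.good => f z) :
    ∃ Y : Config M (Fin 3) T3 → ℝ, Measurable Y ∧ Set.EqOn Y f Φ.good := by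
  refine ⟨fun z => if h : z ∈ Φ.good then f z else 0, Measurable.dite (by simpa using hf) measurable_const
    Φ.measurableSet_good, fun z hz => by simp [hz]⟩

/-- The window integral of a continuous one-body functional, summed over the particles, is measurable on the good set.
[folklore] -/
theorem measurable_sum_windowIntegral (Φ : HardSphereFlow (Torus.geometry (Fin 3)) ε M) {F : T3 × V3 → ℝ}
    (hF : Continuous F) (a c : ℝ) :
    Measurable fun z : Φ.good => ∑ i : Fin M, ∫ r in a..c, F (Φ.flow r (z : Config M (Fin 3) T3) i) :=
  Finset.measurable_sum _ fun i _ => measurable_intervalIntegral_comp_flow_apply Φ hF i a c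

end Orbit

/-! ## §4 Window-size arithmetic -/

/-- For `τ, δ > 0` and `N ≥ ⌈(τ/δ)³⌉₊`: `τ (N+1)^{-1/3} ≤ δ`. [folklore] -/
theorem window_le_of_le {τ δ : ℝ} (hτ : 0 < τ) (hδ : 0 < δ) {N : ℕ} (hN : ⌈(τ / δ) ^ 3⌉₊ ≤ N) :
    τ * ((N : ℝ) + 1) ^ (-(1 / 3 : ℝ)) ≤ δ := by
  have hN1 : (0 : ℝ) < (N : ℝ) + 1 := by positivity
  have hq : 0 ≤ τ / δ := by positivity
  have h1 : (τ / δ) ^ 3 ≤ (N : ℝ) + 1 := by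
    have := Nat.le_ceil ((τ / δ) ^ 3)
    have h' : (⌈(τ / δ) ^ 3⌉₊ : ℝ) ≤ N := by exact_mod_cast hN
    linarith
  -- `(N+1)^{1/3} ≥ τ/δ`
  have h2 : τ / δ ≤ ((N : ℝ) + 1) ^ (1 / 3 : ℝ) := by
    have h3 : ((τ / δ) ^ 3) ^ (1 / 3 : ℝ) ≤ ((N : ℝ) + 1) ^ (1 / 3 : ℝ) :=
      Real.rpow_le_rpow (by positivity) h1 (by norm_num)
    have h4 : ((τ / δ) ^ 3) ^ (1 / 3 : ℝ) = τ / δ := by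
      rw [← Real.rpow_natCast, ← Real.rpow_mul hq]
      norm_num
    rwa [h4] at h3
  have h5 : 0 < ((N : ℝ) + 1) ^ (1 / 3 : ℝ) := Real.rpow_pos_of_pos hN1 _
  rw [Real.rpow_neg hN1.le, ← div_eq_mul_inv, div_le_iff₀ h5]
  calc τ = τ / δ * δ := by field_simp
    _ ≤ ((N : ℝ) + 1) ^ (1 / 3 : ℝ) * δ := mul_le_mul_of_nonneg_right h2 hδ.le
    _ = δ * ((N : ℝ) + 1) ^ (1 / 3 : ℝ) := mul_comm _ _

/-! ## §5 Growth bounds of the kinetic and row integrands -/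

/-- **The traceless stress form has quadratic growth**:
`|Σ_j Σ_k (w_j w_k − δ_{jk}|w|²/3) D_{kj}| ≤ (4/3)|w|² Σ_j Σ_k |D_{kj}|`. [folklore] -/
theorem abs_stressForm_le (wv : V3) (D : Fin 3 → Fin 3 → ℝ) :
    |∑ j : Fin 3, ∑ k : Fin 3, (wv j * wv k - (if j = k then ‖wv‖ ^ 2 / 3 else 0)) * D k j| ≤
      4 / 3 * ‖wv‖ ^ 2 * ∑ j : Fin 3, ∑ k : Fin 3, |D k j| := by
  rw [Finset.mul_sum]
  refine (Finset.abs_sum_le_sum_abs _ _).trans (Finset.sum_le_sum fun j _ => ?_)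
  rw [Finset.mul_sum]
  refine (Finset.abs_sum_le_sum_abs _ _).trans (Finset.sum_le_sum fun k _ => ?_)
  rw [abs_mul]
  refine mul_le_mul_of_nonneg_right ?_ (abs_nonneg _)
  have hj : |wv j| ≤ ‖wv‖ := by have h := PiLp.norm_apply_le wv j; rwa [Real.norm_eq_abs] at h
  have hk : |wv k| ≤ ‖wv‖ := by have h := PiLp.norm_apply_le wv k; rwa [Real.norm_eq_abs] at h
  have h1 : |wv j * wv k| ≤ ‖wv‖ ^ 2 := by
    rw [abs_mul, sq]; exact mul_le_mul hj hk (abs_nonneg _) (norm_nonneg _)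
  have h2 : |(if j = k then ‖wv‖ ^ 2 / 3 else 0)| ≤ ‖wv‖ ^ 2 / 3 := by
    split_ifs
    · rw [abs_of_nonneg (by positivity)]
    · rw [abs_zero]; positivity
  calc |wv j * wv k - (if j = k then ‖wv‖ ^ 2 / 3 else 0)|
      ≤ |wv j * wv k| + |(if j = k then ‖wv‖ ^ 2 / 3 else 0)| := abs_sub _ _
    _ ≤ ‖wv‖ ^ 2 + ‖wv‖ ^ 2 / 3 := add_le_add h1 h2
    _ = 4 / 3 * ‖wv‖ ^ 2 := by ring

/-- **A linear form has linear growth**: `|Σ_k c_k w_k| ≤ (Σ_k |c_k|) |w|`. [folklore] -/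
theorem abs_linForm_le (wv : V3) (c : Fin 3 → ℝ) : |∑ k : Fin 3, c k * wv k| ≤ (∑ k : Fin 3, |c k|) * ‖wv‖ := by
  rw [Finset.sum_mul]
  refine (Finset.abs_sum_le_sum_abs _ _).trans (Finset.sum_le_sum fun k _ => ?_)
  rw [abs_mul]
  have hk : |wv k| ≤ ‖wv‖ := by have h := PiLp.norm_apply_le wv k; rwa [Real.norm_eq_abs] at h
  exact mul_le_mul_of_nonneg_left hk (abs_nonneg _)

/-- **From growth in the peculiar velocity to growth in the velocity**: for `a, b, c ≥ 0` and `‖u_x‖ ≤ U`,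
`a + b‖v − u_x‖ + c‖v − u_x‖² ≤ 2(a + b + c)(1 + U)²(1 + ‖v‖²)`. [folklore] -/
theorem growth_le {a b c U : ℝ} (ha : 0 ≤ a) (hb : 0 ≤ b) (hc : 0 ≤ c) (hU : 0 ≤ U) (ux v : V3) (hux : ‖ux‖ ≤ U) :
    a + b * ‖v - ux‖ + c * ‖v - ux‖ ^ 2 ≤ 2 * (a + b + c) * (1 + U) ^ 2 * (1 + ‖v‖ ^ 2) := by
  have h0 : ‖v - ux‖ ≤ ‖v‖ + U := (norm_sub_le v ux).trans (by linarith)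
  have hv : 0 ≤ ‖v‖ := norm_nonneg v
  have h1 : ‖v - ux‖ ≤ (1 + U) * (1 + ‖v‖ ^ 2) := by nlinarith [sq_nonneg (‖v‖ - 1)]
  have h2 : ‖v - ux‖ ^ 2 ≤ 2 * (1 + U) ^ 2 * (1 + ‖v‖ ^ 2) := by
    have : ‖v - ux‖ ^ 2 ≤ (‖v‖ + U) ^ 2 := pow_le_pow_left₀ (norm_nonneg _) h0 2
    nlinarith [sq_nonneg (‖v‖ * U - 1), mul_nonneg hv hU, sq_nonneg ‖v‖, sq_nonneg U]
  have h3 : a ≤ 2 * a * (1 + U) ^ 2 * (1 + ‖v‖ ^ 2) := by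
    have : (1 : ℝ) ≤ (1 + U) ^ 2 * (1 + ‖v‖ ^ 2) := by nlinarith [sq_nonneg ‖v‖, sq_nonneg U]
    nlinarith
  have h4 : b * ‖v - ux‖ ≤ 2 * b * (1 + U) ^ 2 * (1 + ‖v‖ ^ 2) := by
    have : (1 + U) * (1 + ‖v‖ ^ 2) ≤ 2 * (1 + U) ^ 2 * (1 + ‖v‖ ^ 2) := by nlinarith [sq_nonneg ‖v‖, sq_nonneg U]
    nlinarith
  have h5 : c * ‖v - ux‖ ^ 2 ≤ 2 * c * (1 + U) ^ 2 * (1 + ‖v‖ ^ 2) := by nlinarith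
  nlinarith

end Summit.AtomisticToContinuum.HydrodynamicLimit.Theorems.ClampedCurrentsDockHeart

end
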